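import Mathlib
import Summits.ResolutionOfSingularities.ResolutionOfSingularities.Theorems.WeightedInvariantLocalWeightedDropTOT2NearSetting

/-!
# `WeightedInvariant.LocalWeightedDrop`, TOT₂ line (skeleton v32, residual `stub_spaceNCRankDrop`), piece S-NEAR part 7:
# (N2) WITH HISTORY — `e^O ≤ 1` PERSISTS AT `O`-NEAR ANSWERS (bare, and on decorated states)

Crux item stmt-ResolutionOfSingularities-8899 `LocalWeightedDrop`; sub-line TOT2-LINE v1/v1.1 (`L/res-L1-w43-lead-1/g4/TOT2-LINE.md`) §4
(«(N2) e_{x′} ≤ e_x and e^O_{x′} ≤ e^O_x at (O-)near points»).  [OURS · L1 W4.3, chain w43, res-L1-w43-stub-3 (gen 4) = S-NEAR hand; on top of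
part 2 (`…TOT2NearDir`) and part 6 (`…TOT2NearSetting`, S-SET vocabulary of res-L1-w43-stub-1).  MODEL: Cossart–Jannsen–Saito, LNM 2270, Thm 3.23 (1)
(`e^O` does not grow at O-near points), hypersurface form.  AI-written; gate-accepted means sorry-free with standard axioms, not refereed.  Def-free.]

`Dir^S(in f) := Dir(in f) ∩ ⋂_{l ∈ S} {u_l = 0}` for a set `S` of MARKED LETTERS (the old components `{x_l = 0}`, `l ∈ S`, through the point);
under the point move at `c` with `c_l = 0` for `l ∈ S` (the new point lies on every marked component — `O`-NEAR) the marked letters of the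
successor are `Fin.predAbove i₀ (succ l)` (S-SET's `newLetters` convention; = `j.succ` for `l = i₀.succAbove j`).
* `predAbove_succ_succAbove_succ` — that index identity.
* `eq_zero_of_inv_cons_zero_rel`, **`apexLineRel_of_near`** — part 2's `eq_zero_of_inv_cons_zero` / `apexLine_of_near` with the marked
  letters carried along: if every two vectors of `Dir^S(in f)` are dependent, then at an `O`-near point every two vectors of
  `Dir^{S′}(in G′)` are dependent (`e^S ≤ 1` persists).
* `Decoration.through_of_card_O_eq` — on decorated states, «`|O′| = |O|` at an answer where the order did not drop» ⇒ every old component passes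
  through the new point (`c_{strIdx Φ l} = 0` for `l ∈ O`).
* **`Decoration.apexLineO_transform`** — (N2) WITH HISTORY on decorated states: `hone` for `Dir^O(in (f∘Φ))` (old letters `strIdx Φ l`,
  `l ∈ δ.O`) and an answer with unchanged head `(o, |O|)` ⇒ `hone` for `Dir^{O′}(in f′)` of the transform (`O′ = (δ.transform Φ w c i).O`).
-/

set_option linter.dupNamespace false -- mandated namespace of this single-conjunct summit
set_option autoImplicit false

noncomputable section

namespace Summit.ResolutionOfSingularities.ResolutionOfSingularities.Theorems

namespace TOT2Near

open MvPowerSeries Literature.AlgebraicGeometry.Resolution TameFourTupleDrop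

variable {k : Type} [Field k]

/-! ## §1 Bare form: part 2 with marked letters -/

/-- The successor letter of the old letter `i₀.succAbove j` is `j.succ`: `predAbove i₀ (succ (i₀.succAbove j)) = j.succ`. -/
theorem predAbove_succ_succAbove_succ {n : ℕ} (i₀ : Fin (n + 1)) (j : Fin n) :
    Fin.predAbove i₀ (i₀.succAbove j).succ = j.succ := by
  rw [← Fin.succ_succAbove_succ, CobordantChartPlaneSlice.predAbove_succ_succAbove]

/-- Part 2's `eq_zero_of_inv_cons_zero` WITH MARKED LETTERS: at an `O`-near point (`c_l = 0` on the marked letters `S`), if every two vectors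
of `Dir^S(in f)` are dependent, an invariance vector `(0, u′)` of the successor's form vanishing on the new marked letters has `u′ = 0`. -/
theorem eq_zero_of_inv_cons_zero_rel {n : ℕ} (f : MvPowerSeries (Fin (n + 1)) k) (c : Fin (n + 1) → k) (i₀ : Fin (n + 1))
    (hc : c i₀ ≠ 0) {o : ℕ} {G : MvPowerSeries (Fin (n + 1 + 1)) k}
    (hfac : subst (CobordantChart.chart (fun _ : Fin (n + 1) => 1) c) f = X 0 ^ o * G)
    (hnear : (o : ℕ∞) ≤ (TupleGame.slice i₀ G).order) (S : Finset (Fin (n + 1))) (hcS : ∀ l ∈ S, c l = 0)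
    (honeS : ∀ u₁ u₂ : Fin (n + 1) → k,
      (∀ v, CobordantChart.initEval (fun _ : Fin (n + 1) => 1) (v + u₁) o f = CobordantChart.initEval (fun _ : Fin (n + 1) => 1) v o f) →
      (∀ l ∈ S, u₁ l = 0) →
      (∀ v, CobordantChart.initEval (fun _ : Fin (n + 1) => 1) (v + u₂) o f = CobordantChart.initEval (fun _ : Fin (n + 1) => 1) v o f) →
      (∀ l ∈ S, u₂ l = 0) →
      ∃ α β : k, (α ≠ 0 ∨ β ≠ 0) ∧ α • u₁ + β • u₂ = 0)
    {u' : Fin n → k}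
    (hu : ∀ w, CobordantChart.initEval (fun _ : Fin (n + 1) => 1) (w + Fin.cons (0 : k) u') o (TupleGame.slice i₀ G) =
      CobordantChart.initEval (fun _ : Fin (n + 1) => 1) w o (TupleGame.slice i₀ G))
    (huS : ∀ l ∈ S, (Fin.cons (0 : k) u' : Fin (n + 1) → k) (Fin.predAbove i₀ l.succ) = 0) :
    u' = 0 := by
  have hvan : ∀ l ∈ S, (Fin.insertNth i₀ (0 : k) u' : Fin (n + 1) → k) l = 0 := by
    intro l hl
    have hli : l ≠ i₀ := by
      rintro rfl
      exact hc (hcS _ hl)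
    obtain ⟨j, rfl⟩ := Fin.exists_succAbove_eq hli
    rw [Fin.insertNth_apply_succAbove]
    have h := huS _ hl
    rwa [predAbove_succ_succAbove_succ, Fin.cons_succ] at h
  obtain ⟨α, β, hαβ, hrel⟩ := honeS _ c (insertNth_inv_of_inv_cons_zero f c i₀ hc hfac hnear hu) hvan (fun v => by
    have h := initEval_add_smul_eq_of_near f c i₀ hc hfac hnear 1 v
    rwa [one_smul] at h) hcS
  have hi₀ := congr_fun hrel i₀
  simp only [Pi.add_apply, Pi.smul_apply, Fin.insertNth_apply_same, smul_eq_mul, mul_zero, zero_add, Pi.zero_apply] at hi₀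
  have hβ : β = 0 := (mul_eq_zero.mp hi₀).resolve_right hc
  have hα : α ≠ 0 := hαβ.resolve_right fun h => h hβ
  funext j
  have hj := congr_fun hrel (i₀.succAbove j)
  simp only [Pi.add_apply, Pi.smul_apply, Fin.insertNth_apply_succAbove, hβ, zero_smul, add_zero, smul_eq_mul, Pi.zero_apply] at hj
  exact (mul_eq_zero.mp hj).resolve_left hα

/-- **(N2) WITH MARKED LETTERS — `e^S ≤ 1` PERSISTS AT AN `O`-NEAR POINT** (bare form): under the point move at `c` (live slot `i₀`,
`f(s(c + y)) = s^o · G`) with NEAR successor and `c_l = 0` on the marked letters `S`: if every two vectors of `Dir^S(in_o f)` are dependent,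
then every two invariance vectors of `in_o G′` vanishing on the successor's marked letters `predAbove i₀ (succ l)`, `l ∈ S`, are dependent. -/
theorem apexLineRel_of_near {n : ℕ} (f : MvPowerSeries (Fin (n + 1)) k) (c : Fin (n + 1) → k) (i₀ : Fin (n + 1))
    (hc : c i₀ ≠ 0) {o : ℕ} {G : MvPowerSeries (Fin (n + 1 + 1)) k}
    (hfac : subst (CobordantChart.chart (fun _ : Fin (n + 1) => 1) c) f = X 0 ^ o * G)
    (hnear : (o : ℕ∞) ≤ (TupleGame.slice i₀ G).order) (S : Finset (Fin (n + 1))) (hcS : ∀ l ∈ S, c l = 0)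
    (honeS : ∀ u₁ u₂ : Fin (n + 1) → k,
      (∀ v, CobordantChart.initEval (fun _ : Fin (n + 1) => 1) (v + u₁) o f = CobordantChart.initEval (fun _ : Fin (n + 1) => 1) v o f) →
      (∀ l ∈ S, u₁ l = 0) →
      (∀ v, CobordantChart.initEval (fun _ : Fin (n + 1) => 1) (v + u₂) o f = CobordantChart.initEval (fun _ : Fin (n + 1) => 1) v o f) →
      (∀ l ∈ S, u₂ l = 0) →
      ∃ α β : k, (α ≠ 0 ∨ β ≠ 0) ∧ α • u₁ + β • u₂ = 0)
    (w₁ w₂ : Fin (n + 1) → k)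
    (hw₁ : ∀ w, CobordantChart.initEval (fun _ : Fin (n + 1) => 1) (w + w₁) o (TupleGame.slice i₀ G) =
      CobordantChart.initEval (fun _ : Fin (n + 1) => 1) w o (TupleGame.slice i₀ G))
    (hw₁S : ∀ l ∈ S, w₁ (Fin.predAbove i₀ l.succ) = 0)
    (hw₂ : ∀ w, CobordantChart.initEval (fun _ : Fin (n + 1) => 1) (w + w₂) o (TupleGame.slice i₀ G) =
      CobordantChart.initEval (fun _ : Fin (n + 1) => 1) w o (TupleGame.slice i₀ G))
    (hw₂S : ∀ l ∈ S, w₂ (Fin.predAbove i₀ l.succ) = 0) :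
    ∃ α β : k, (α ≠ 0 ∨ β ≠ 0) ∧ α • w₁ + β • w₂ = 0 := by
  have hcomb : w₂ 0 • w₁ - w₁ 0 • w₂ = 0 := by
    have h0 : (w₂ 0 • w₁ - w₁ 0 • w₂) 0 = 0 := by
      show w₂ 0 * w₁ 0 - w₁ 0 * w₂ 0 = 0
      ring
    have hinv : ∀ w, CobordantChart.initEval (fun _ : Fin (n + 1) => 1) (w + (w₂ 0 • w₁ - w₁ 0 • w₂)) o (TupleGame.slice i₀ G) =
        CobordantChart.initEval (fun _ : Fin (n + 1) => 1) w o (TupleGame.slice i₀ G) :=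
      inv_smul_sub_smul hw₁ hw₂ (w₂ 0) (w₁ 0)
    have hS : ∀ l ∈ S, (w₂ 0 • w₁ - w₁ 0 • w₂) (Fin.predAbove i₀ l.succ) = 0 := fun l hl => by
      simp only [Pi.sub_apply, Pi.smul_apply, smul_eq_mul, hw₁S l hl, hw₂S l hl, mul_zero, sub_zero]
    rw [eq_cons_zero_tail h0] at hinv hS ⊢
    rw [eq_zero_of_inv_cons_zero_rel f c i₀ hc hfac hnear S hcS honeS hinv hS, cons_zero_zero]
  by_cases h : w₁ 0 = 0 ∧ w₂ 0 = 0
  · have hw₁0 : w₁ = 0 := by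
      have hinv := hw₁
      have hS := hw₁S
      rw [eq_cons_zero_tail h.1] at hinv hS ⊢
      rw [eq_zero_of_inv_cons_zero_rel f c i₀ hc hfac hnear S hcS honeS hinv hS, cons_zero_zero]
    exact ⟨1, 0, Or.inl one_ne_zero, by rw [hw₁0, smul_zero, zero_smul, add_zero]⟩
  · refine ⟨w₂ 0, -w₁ 0, ?_, by rw [neg_smul, ← sub_eq_add_neg, hcomb]⟩
    rw [not_and_or] at h
    rcases h with h | h
    · exact Or.inr (neg_ne_zero.mpr h)
    · exact Or.inl h

/-- **`e^S ≤ 1` AND A CENTRE OF POSITIVE DIMENSION TANGENT TO NO MARKED LETTER ⇒ NO `O`-NEAR POINT** (bare form, general weights): as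
part 3's `order_slice_lt_of_apexLine_curve`, with the marked letters carried along — `c` (vanishing on `S`) and the tangent letter `e_l`
(`w_l = 0`, `l ∉ S`) would be two independent vectors of `Dir^S`. -/
theorem order_slice_lt_of_apexLineRel_curve {n : ℕ} (w : Fin (n + 1) → ℕ) (c : Fin (n + 1) → k) (hw : ∀ l, w l ≤ 1)
    (hc0 : ∀ l, w l = 0 → c l = 0) (i₀ : Fin (n + 1)) (hc : c i₀ ≠ 0) (f : MvPowerSeries (Fin (n + 1)) k) {o : ℕ}
    (hperm : (o : ℕ∞) ≤ f.weightedOrder w) (S : Finset (Fin (n + 1))) (hcS : ∀ l ∈ S, c l = 0)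
    (honeS : ∀ u₁ u₂ : Fin (n + 1) → k,
      (∀ v, CobordantChart.initEval (fun _ : Fin (n + 1) => 1) (v + u₁) o f = CobordantChart.initEval (fun _ : Fin (n + 1) => 1) v o f) →
      (∀ l ∈ S, u₁ l = 0) →
      (∀ v, CobordantChart.initEval (fun _ : Fin (n + 1) => 1) (v + u₂) o f = CobordantChart.initEval (fun _ : Fin (n + 1) => 1) v o f) →
      (∀ l ∈ S, u₂ l = 0) →
      ∃ α β : k, (α ≠ 0 ∨ β ≠ 0) ∧ α • u₁ + β • u₂ = 0)
    {l : Fin (n + 1)} (hl : w l = 0) (hlS : l ∉ S) {G : MvPowerSeries (Fin (n + 1 + 1)) k}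
    (hfac : subst (CobordantChart.chart w c) f = X 0 ^ o * G) :
    (TupleGame.slice i₀ G).order < o := by
  by_contra hle
  rw [not_lt] at hle
  have hli₀ : l ≠ i₀ := by
    rintro rfl
    exact hc (hc0 _ hl)
  obtain ⟨α, β, hαβ, hrel⟩ := honeS c (Pi.single l 1)
    (fun v => by
      have h := initEval_add_smul_eq_of_near_curve w c hw hc0 i₀ hc f hperm hfac hle 1 v
      rwa [one_smul] at h)
    hcS
    (initEval_add_eq_of_perm hw hperm fun l' hl' => by
      rw [Pi.single_apply, if_neg]
      rintro rfl
      exact hl' hl)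
    (fun l' hl' => by
      rw [Pi.single_apply, if_neg]
      rintro rfl
      exact hlS hl')
  have h1 := congr_fun hrel i₀
  have h2 := congr_fun hrel l
  simp only [Pi.add_apply, Pi.smul_apply, smul_eq_mul, Pi.single_eq_of_ne hli₀.symm, mul_zero, add_zero,
    Pi.zero_apply, mul_eq_zero] at h1
  have hα : α = 0 := h1.resolve_right hc
  simp only [Pi.add_apply, Pi.smul_apply, smul_eq_mul, hc0 l hl, mul_zero, zero_add, Pi.single_eq_same, mul_one,
    Pi.zero_apply] at h2
  exact hαβ.elim (fun h => h hα) (fun h => h h2)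

/-! ## §2 Decorated form: (N2) with history -/

variable {m : ℕ}
variable {δ : Decoration k m} {Φ : Fin (m + 1) → MvPowerSeries (Fin (m + 1)) k} {w : Fin (m + 1) → ℕ} {c : Fin (m + 1) → k}
  {i : Fin (m + 1)}

/-- **(P2) READS: EVERY OLD COMPONENT CONTAINS THE CENTRE**, i.e. its straightened letter is a centre letter: `w (strIdx Φ l₀) ≠ 0` for
`l₀ ∈ O`. -/
theorem Decoration.w_strIdx_ne_zero (hperm : IsBPermissible δ Φ w) {l₀ : Fin (m + 1)} (hl₀ : l₀ ∈ δ.O) : w (strIdx Φ l₀) ≠ 0 := by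
  intro h0
  obtain ⟨u, hu, hul⟩ := strIdx_spec (hperm.2.2.2 l₀ (δ.O_subset hl₀))
  have h1 := hperm.2.2.1 l₀ hl₀
  rw [hul, weightedOrder_mul] at h1
  have hu0 : u.weightedOrder w ≤ 0 := by
    have h := weightedOrder_le (w := w) (f := u) (d := 0) (by rw [coeff_zero_eq_constantCoeff_apply]; exact hu)
    rwa [map_zero, Nat.cast_zero] at h
  have hX : (X (strIdx Φ l₀) : MvPowerSeries (Fin (m + 1)) k).weightedOrder w ≤ 0 := by
    rw [X_def, weightedOrder_monomial_of_ne_zero (w := w) (one_ne_zero' k), Finsupp.weight_single, h0, smul_zero, Nat.cast_zero]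
  have h2 : (1 : ℕ∞) ≤ 0 := h1.trans (by simpa using add_le_add hu0 hX)
  exact absurd h2 (by norm_num)

open Classical in
/-- **`|O′| = |O|` MEANS EVERY OLD COMPONENT PASSES THROUGH THE NEW POINT**: at an answer where the order did not drop, if the transform keeps as
many old letters as before then `c_{strIdx Φ l} = 0` for every `l ∈ O`. -/
theorem Decoration.through_of_card_O_eq (h : ¬ ((sqfRep (δ.strict Φ w c i)).order).toNat < δ.o)
    (hcard : (δ.transform Φ w c i).O.card = δ.O.card) : ∀ l ∈ δ.O, c (strIdx Φ l) = 0 := by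
  rw [Decoration.transform_O_of_not_lt _ _ _ _ _ h] at hcard
  unfold Decoration.newLetters at hcard
  have h1 := Finset.card_image_le (s := δ.O.filter fun l => c (strIdx Φ l) = 0)
    (f := fun l => Fin.predAbove i (Fin.succ (strIdx Φ l)))
  have h2 := Finset.card_filter_le δ.O (fun l => c (strIdx Φ l) = 0)
  exact Finset.card_filter_eq_iff.mp (le_antisymm h2 (hcard ▸ h1))

open Classical in
/-- **(N2) WITH HISTORY ON DECORATED STATES — `e^O ≤ 1` PERSISTS WHILE THE HEAD `(o, |O|)` IS UNCHANGED**: if every two vectors of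
`Dir^O(in (f∘Φ))` (invariance vectors of the degree-`o` form vanishing on the old letters `strIdx Φ l`, `l ∈ O`, of the move's coordinates) are
dependent, and at the answer `(c, i)` neither the order nor the number of old components dropped, then every two vectors of `Dir^{O′}(in f′)`
of the transform are dependent (and the move was the point move). -/
theorem Decoration.apexLineO_transform (hperm : IsBPermissible δ Φ w) (hc0 : ∀ l, w l = 0 → c l = 0) (hf : δ.f ≠ 0) (hci : c i ≠ 0)
    (honeO : ∀ u₁ u₂ : Fin (m + 1) → k,
      (∀ v, CobordantChart.initEval (fun _ : Fin (m + 1) => 1) (v + u₁) δ.o (subst Φ δ.f) =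
        CobordantChart.initEval (fun _ : Fin (m + 1) => 1) v δ.o (subst Φ δ.f)) →
      (∀ l ∈ δ.O, u₁ (strIdx Φ l) = 0) →
      (∀ v, CobordantChart.initEval (fun _ : Fin (m + 1) => 1) (v + u₂) δ.o (subst Φ δ.f) =
        CobordantChart.initEval (fun _ : Fin (m + 1) => 1) v δ.o (subst Φ δ.f)) →
      (∀ l ∈ δ.O, u₂ (strIdx Φ l) = 0) →
      ∃ α β : k, (α ≠ 0 ∨ β ≠ 0) ∧ α • u₁ + β • u₂ = 0)
    (heq : (δ.transform Φ w c i).o = δ.o) (hcard : (δ.transform Φ w c i).O.card = δ.O.card) (w₁ w₂ : Fin (m + 1) → k)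
    (hw₁ : ∀ v, CobordantChart.initEval (fun _ : Fin (m + 1) => 1) (v + w₁) (δ.transform Φ w c i).o (δ.transform Φ w c i).f =
      CobordantChart.initEval (fun _ : Fin (m + 1) => 1) v (δ.transform Φ w c i).o (δ.transform Φ w c i).f)
    (hw₁O : ∀ l' ∈ (δ.transform Φ w c i).O, w₁ l' = 0)
    (hw₂ : ∀ v, CobordantChart.initEval (fun _ : Fin (m + 1) => 1) (v + w₂) (δ.transform Φ w c i).o (δ.transform Φ w c i).f =
      CobordantChart.initEval (fun _ : Fin (m + 1) => 1) v (δ.transform Φ w c i).o (δ.transform Φ w c i).f)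
    (hw₂O : ∀ l' ∈ (δ.transform Φ w c i).O, w₂ l' = 0) :
    ∃ α β : k, (α ≠ 0 ∨ β ≠ 0) ∧ α • w₁ + β • w₂ = 0 := by
  have hnlt : ¬ ((sqfRep (δ.strict Φ w c i)).order).toNat < δ.o := by
    rw [← Decoration.transform_o]
    exact fun h => absurd heq (ne_of_lt h)
  have hthrough := Decoration.through_of_card_O_eq hnlt hcard
  obtain ⟨hfac, -, hnear⟩ := Decoration.nearData_of_o_transform_eq hperm hc0 hf hci heq
  -- the marked letters of the move's coordinates
  set S : Finset (Fin (m + 1)) := δ.O.image (strIdx Φ) with hS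
  have hcS : ∀ l' ∈ S, c l' = 0 := by
    rw [hS, Finset.forall_mem_image]
    exact hthrough
  have honeS : ∀ u₁ u₂ : Fin (m + 1) → k,
      (∀ v, CobordantChart.initEval (fun _ : Fin (m + 1) => 1) (v + u₁) δ.o (subst Φ δ.f) =
        CobordantChart.initEval (fun _ : Fin (m + 1) => 1) v δ.o (subst Φ δ.f)) →
      (∀ l' ∈ S, u₁ l' = 0) →
      (∀ v, CobordantChart.initEval (fun _ : Fin (m + 1) => 1) (v + u₂) δ.o (subst Φ δ.f) =
        CobordantChart.initEval (fun _ : Fin (m + 1) => 1) v δ.o (subst Φ δ.f)) →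
      (∀ l' ∈ S, u₂ l' = 0) →
      ∃ α β : k, (α ≠ 0 ∨ β ≠ 0) ∧ α • u₁ + β • u₂ = 0 := by
    intro u₁ u₂ h₁ h₁S h₂ h₂S
    rw [hS, Finset.forall_mem_image] at h₁S h₂S
    exact honeO u₁ u₂ h₁ h₁S h₂ h₂S
  -- the centre is the point
  have hw1 : w = fun _ => 1 := by
    funext l
    refine le_antisymm (hperm.1.2.2.1 l) (Nat.one_le_iff_ne_zero.mpr fun hl => ?_)
    have hlS : l ∉ S := by
      rw [hS, Finset.mem_image]
      rintro ⟨l₀, hl₀, rfl⟩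
      exact Decoration.w_strIdx_ne_zero hperm hl₀ hl
    exact absurd hnear (not_le.mpr (order_slice_lt_of_apexLineRel_curve w c hperm.1.2.2.1 hc0 i hci (subst Φ δ.f)
      (Decoration.weightedOrder_ge hperm hf) S hcS honeS hl hlS hfac))
  -- the new marked letters
  have hnew : ∀ {u : Fin (m + 1) → k}, (∀ l' ∈ (δ.transform Φ w c i).O, u l' = 0) →
      ∀ l' ∈ S, u (Fin.predAbove i l'.succ) = 0 := by
    intro u hu
    rw [hS, Finset.forall_mem_image]
    intro l hl
    refine hu _ ?_
    rw [Decoration.transform_O_of_not_lt _ _ _ _ _ hnlt]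
    unfold Decoration.newLetters
    exact Finset.mem_image.mpr ⟨l, Finset.mem_filter.mpr ⟨hl, hthrough l hl⟩, rfl⟩
  have hw₁S := hnew hw₁O
  have hw₂S := hnew hw₂O
  rw [heq, Decoration.transform_f_eq_strict_of_o_transform_eq hperm hc0 hf hci heq] at hw₁ hw₂
  subst hw1
  exact apexLineRel_of_near (subst Φ δ.f) c i hci hfac hnear S hcS honeS w₁ w₂ hw₁ hw₁S hw₂ hw₂S

end TOT2Near

end Summit.ResolutionOfSingularities.ResolutionOfSingularities.Theorems

end
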